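import Summits.ABC.ABC.Theorems.CongruentialReceptacleTameLocalReceptacleEngineCellsDefs

/-!
# Crux `CongruentialReceptacle.TameLocalReceptacle` (stmt-ABC-14354), line `grh-friable-cell-resolution`:
# nonemptiness of the five witness families (registered stub `stub_nonemptyCells`)

Registered stub `stub_nonemptyCells : FamilySize → NonemptyCells` of the checked skeleton (v6)
`Cruxes/TameLocalReceptacle/Lines/grh_friable_cell_resolution.lean` (lead `prover-line-stmt-ABC-14354-a1-0`),
over the family-level vocabulary of `…TameLocalReceptacleEngineCellsDefs.lean` (`masterScale`, `levelOf`,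
`famFA`, `famFB`, `famFC`, `famG`, `famG'`, `FamilySize`, `NonemptyCells`).

PROOF.  Fix a depth `N ≥ 1`; `FamilySize` supplies `c > 0` and `M₀` with
`c · Ψ(x, y)³ / x ≤ #F` for each of the five families `F`, all `M ≥ M₀`
(`x = masterScale N M = 48 · 2^N · M`, `y = levelOf N M`, `Ψ(x, y) = #(Nat.smoothNumbersUpTo ⌊x⌋₊ (y+1))`).
Take `M₁ := max M₀ 1`.  For `M ≥ M₁` we have `x ≥ 48 ≥ 1`, so `1 ∈ Nat.smoothNumbersUpTo ⌊x⌋₊ (y+1)`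
(the number `1` has no prime factor) and `Ψ(x, y) ≥ 1`; hence `c · Ψ³ / x > 0`, so `(#F : ℝ) > 0`,
i.e. `F` is nonempty.  (Worker log: complete; no helper beyond the two private lemmas below.)
-/

-- `Summit.<Summit>.<Problem>` is the mandated summit-side namespace (CONVENTIONS §2); for the
-- single-conjunct summit `ABC` the two coincide, so the duplicate `ABC.ABC` is deliberate.
set_option linter.dupNamespace false

namespace Summit.ABC.ABC.Theorems.TameLocalReceptacle

open Finset

/-- The master scale is at least `1` as soon as `M ≥ 1` (indeed `x = 48 · 2^N · M ≥ 48`). [folklore] -/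
private theorem one_le_masterScale {N M : ℕ} (hM : 1 ≤ M) : (1 : ℝ) ≤ masterScale N M := by
  unfold masterScale
  have h2 : (1 : ℝ) ≤ 2 ^ N := one_le_pow₀ (by norm_num)
  have hM' : (1 : ℝ) ≤ M := by exact_mod_cast hM
  nlinarith

/-- `Ψ(x, y) ≥ 1` for `x ≥ 1`: the number `1` is `y`-friable and `≤ ⌊x⌋₊`. [folklore] -/
private theorem one_le_card_smoothNumbersUpTo_floor {x : ℝ} (hx : 1 ≤ x) (k : ℕ) :
    (1 : ℝ) ≤ ((Nat.smoothNumbersUpTo ⌊x⌋₊ k).card : ℝ) := by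
  have h1 : 1 ∈ Nat.smoothNumbersUpTo ⌊x⌋₊ k := by
    rw [Nat.mem_smoothNumbersUpTo]
    refine ⟨Nat.le_floor (by simpa using hx), ?_⟩
    exact Nat.mem_smoothNumbers'.mpr fun _ hp hd => absurd (Nat.dvd_one.mp hd) hp.ne_one
  have : 1 ≤ (Nat.smoothNumbersUpTo ⌊x⌋₊ k).card := Finset.card_pos.2 ⟨1, h1⟩
  exact_mod_cast this

/-- **Registered stub `stub_nonemptyCells`.**  The size bound `#F ≥ c · Ψ(x, y)³ / x` (with `c > 0`,
`Ψ(x, y) ≥ 1`, `x > 0`) forces each of the five witness families to be nonempty for all large `M`. [folklore] -/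
theorem stub_nonemptyCells : FamilySize → NonemptyCells := by
  intro hFS N hN
  obtain ⟨c, hc, M₀, hM₀⟩ := hFS N hN
  refine ⟨max M₀ 1, fun M hM => ?_⟩
  have hM₀M : M₀ ≤ M := le_of_max_le_left hM
  have hM1 : 1 ≤ M := le_of_max_le_right hM
  have hx : (1 : ℝ) ≤ masterScale N M := one_le_masterScale hM1
  have hΨ : (1 : ℝ) ≤ ((Nat.smoothNumbersUpTo ⌊masterScale N M⌋₊ (levelOf N M + 1)).card : ℝ) :=
    one_le_card_smoothNumbersUpTo_floor hx _
  have hpos : (0 : ℝ) <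
      c * ((Nat.smoothNumbersUpTo ⌊masterScale N M⌋₊ (levelOf N M + 1)).card : ℝ) ^ 3 / masterScale N M :=
    div_pos (mul_pos hc (pow_pos (zero_lt_one.trans_le hΨ) 3)) (zero_lt_one.trans_le hx)
  have key : ∀ F : Finset (ℕ × ℕ × ℕ),
      (F = famFA N M ∨ F = famFB N M ∨ F = famFC N M ∨ F = famG N M ∨ F = famG' N M) → F.Nonempty := by
    intro F hF
    have hcard : (0 : ℝ) < (F.card : ℝ) := hpos.trans_le (hM₀ M hM₀M F hF)
    exact Finset.card_pos.1 (by exact_mod_cast hcard)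
  exact ⟨key _ (Or.inl rfl), key _ (Or.inr (Or.inl rfl)), key _ (Or.inr (Or.inr (Or.inl rfl))),
    key _ (Or.inr (Or.inr (Or.inr (Or.inl rfl)))), key _ (Or.inr (Or.inr (Or.inr (Or.inr rfl))))⟩

end Summit.ABC.ABC.Theorems.TameLocalReceptacle
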